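import Literature.MathematicalPhysics.QuantumFieldTheory.Balaban1983to89.T4HistoryLipschitzRecursion
import Literature.MathematicalPhysics.QuantumFieldTheory.Balaban1983to89.T4InputCauchyRateData
import Summits.QuantumFields.BalabanUV.T4Continuum.Support.B13HistDatum
import Summits.QuantumFields.BalabanUV.T4Continuum.Support.NE9EvaluationChannel
import Summits.QuantumFields.BalabanUV.T4Continuum.Support.NE9Lemma1Counting

/-!
# InsertionChannelReading — the NE5-W3 × NE9-S5 JUNCTION: the one-run insertion binders of a step model (row NE5, node U3)
# whose history insertion READS a localization channel of `T4HistoryLipschitzRecursion` (row NE9) on background-constant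
# families — `InsBlind` ⟸ `ChannelLocal`, `InsAffine` ⟸ `ChannelAdditive`, `InsHomog` ⟸ `ChannelHomog`, and the wall W3
# `InsScaleBoundLevel W κ c ω` ⟸ `ChannelSizeAtStepNN` + the weight dictionary; corollaries BY NAME for NE9-P2's evaluation
# channels (W3 ⟸ the kernel-mass inequality) and NE9-P1's PIECE FORM of [II] (1.23)∕(1.33) (W3 with `c = (6L)⁴`, `ω = L⁻¹`
# from `PieceBound` + `LevelCounts`)
# (cell `pub-balaban`, T⁴ fan-out; `HOME/t4/b2b-balaban-t4-ne5-p1/O1-CLAIM-TABLE-NE5-P1.md` row O1-c HISTORY ∕ TABLES, whose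
# remit is the insertion's one-run binders; journal INTENT «NE5-W3 × NE9-S5 JUNCTION»)

Unit `b2b-balaban-t4-ne5-formalise-leaf-06` (NE5 formalisation swarm, leaf prover 06, gen 2).  Summits-side NEW WORK under the
LEAN PLACEMENT RULE (cell modelling + bookkeeping; nothing of the manuscripts under audit is asserted; 0 cite tags).  HONEST
FRAMING: rung (B)+1 of the FINITE-VOLUME T⁴ continuum programme — NOT infinite volume, NOT a mass gap, NOT the Clay problem, NOT a
proof of NE5 (`T4OutputRate.NE5`, NOT PRINTED; cell GAPS G-t4-U3-1) nor of NE9 (`T4OutputRate.NE9`, NOT PRINTED); spine 0/9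
unchanged.  HONEST DEPENDENCY (cell line, verbatim): continuum YM on T⁴ ⇐ BetaPertH ∧ nine spine estimates (0/9 proved);
BetaPertH ⇐ (D1) ∧ (D4) ∧ CAP+tail; G-an2-4 gates asym, D1 and NE2/3/4.

WHY.  Rows NE5 and NE9 both type the localization (1.33) p. 9 of [II] = [Balaban1988RG2Cluster] with DIFFERENT carriers of
the same one-run size statement: row NE5's `M.insA g U k : (C.Dom → ℝ) → Hist` (`T4InputCauchyRateData.StepModel`) maps the
TABLE of run A's earlier outputs (their VALUES at the run's background) to the inserted history, with the wall W3 =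
`InsScaleBoundLevel W κ c ω` (G-ne5p1-3a″: a scale-`j < k` table of level `T·e^{−κd}` moves the step-`k` history by
`≤ rHist k·c·ω^{k−1−j}·T`); row NE9's channel `T k s H y` (`T4HistoryLipschitzRecursion`) maps the FAMILY `H : Bg → C.Dom → ℝ` of
old terms to the localized potential at the output index `y`, with the size binder S5 = `ChannelSizeAtStepNN Adm T κ wt τ` (a
creation-step-`j ≤ k` family with `|H U X| ≤ e^{−κd(X)}·N` gives `|T k s H y| ≤ wt k y·τ k j·N`).  On the Hist of record
`B13HistDatum.Hist F` (sup-normed tables over the entries of a frame `F`, physical read-outs `F.read h i = F.wt i·h ⟨i⟩`) the two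
are ONE statement as soon as the insertion READS the channel; then a discharge of S5 for a channel class (NE9-P2's kernel-mass
inequality; NE9-P1's `channelSizeAtStepNN_piece` from the (1.24)×(1.25)-SHAPE `PieceBound` and the p. 8 `LevelCounts`) IS a
discharge of W3 for every NE5 step model reading that channel — with print's `ω = L⁻¹`, `c = (6L)⁴` (p. 8 l. 9–10 *"This yields
(6L)⁴Lʲη"*) for the piece form.
THE READING (MODEL LEVEL — the P1 model's reading of the earlier terms as VALUES, `B13HistInsertion`'s MODELLING NOTE, owner R8;
an MI-R-class identification, not an estimate; nothing of [II] asserted): `ReadsChannel M T out W` — step `0` inserts nothing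
table-driven, and for every entry `i : F.Idx`, `F.read (M.insA g U (k+1) t) i − F.read (M.insA g U (k+1) 0) i = T k g (constFam t)
(out i)` with `constFam t := fun _ X => t X` the BACKGROUND-CONSTANT family and `out : F.Idx → ι` the entry's output index (shift
forced: NE5's step-`k` insertion reads the scales `< k`, NE9's `T k` reads the creation steps `≤ k`).

WHAT THIS FILE TYPES (bookkeeping ∕ [folklore]; all conclusions are the tree's shapes BY NAME; 0 sorry):
* §1 `constFam`; the SHAPE `ChannelHomog Adm T` (ℝ-homogeneity of a channel — NE9 types the pieces of (1.23) as ADDITIVE maps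
  `(Bg → ℝ) →+ ℝ`, so homogeneity is a separate displayed structure binder; PROVED for evaluation channels in §5); the read-out
  dictionary of the Hist of record (`read_sub`, `read_smul`, `eq_of_read_eq`).  §2 `ReadsChannel M T out W`.
* §3 structure binders: `insBlind_of_readsChannel` (⟸ `ChannelLocal`), `insAffine_of_readsChannel` (⟸ `ChannelAdditive`),
  `insHomog_of_readsChannel` (⟸ `ChannelHomog`) — each with `constFam t ∈ Adm`.
* §4 W3: `insScaleBoundLevel_of_readsChannel` (⟸ `ChannelSizeAtStepNN Adm T κ wt τ`, the profile `τ k j ≤ c·ω^{k−j}`, and the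
  WEIGHT DICTIONARY `0 ≤ wt k (out i) ≤ rHist (k+1)·F.wt i`), `insScaleBound_of_readsChannel`, `insertion_binders_of_readsChannel`.
* §5 NE9-P2's evaluation channels `NE9EvaluationChannel.evalChannel F ν w bg`: `channelHomog_eval`, `constFam_mem_evalAdm`,
  **`insertion_binders_of_readsEvalChannel`** — the four NE5 insertion binders from `ReadsChannel`, integrable weights, source
  locality and THE KERNEL-MASS INEQUALITY `Σ_{X ∈ F k s y, scale X = j} e^{−κd(X)}·∫|w| ∂ν ≤ wt k y·τ k j` (NE9-P2's displayed binder;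
  `channelSizeAtStepNN_of_kernelMass` BY NAME).
* §6 NE9-P1's PIECE FORM `NE9Lemma1Counting.pieceChannel P`: **`insScaleBoundLevel_of_readsPieceChannel`** —
  `M.InsScaleBoundLevel W κ ((6L)⁴) L⁻¹` from `SrcScale`, `PieceBound` ((1.24)×(1.25) SHAPE, displayed in row NE9 — proof-interior
  of [I] §§3–5, NOT a printed statement, NOT proved here), `LevelCounts` ((1.26)–(1.28) p. 8; a HYPOTHESIS here — its GAIN variant
  `NE9Lemma1Gain.LevelCountsG` is what row NE9 proves on the carriers of record modulo its O1-side identification binders,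
  `NE9LevelCountsRecordFive.levelCountsG_of_record₅_agePow`; the gain-parametric W3 is `InsertionChannelEnd` §1 [DOCFIX v1.0.1]),
  `0 ≤ Kp`, `0 ≤ O1`, `1 < L` and the weight dictionary for `weightOf P κ₁ d0 O1 Kp`, via
  `channelSizeAtStepNN_piece_printed` BY NAME; `insBlind_insAffine_of_readsPieceChannel` (`Adm := univ`); `InsHomog` for additive
  pieces stays the displayed `ChannelHomog univ (pieceChannel P)`.
CONSUMER (owner gen 31, `Support/OutputRateCount124.lean`): the END faces `ne5_at_of_stepModel_fibre_count124_nat` ∕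
`…_lip_count124_nat` at the letters `c = (6L)⁴`, `ω = L⁻¹` take `hunit : InsScaleBound W κ E₁ ((6L)⁴) L⁻¹` — §6's
`insScaleBound_of_readsPieceChannel` — with the census consequence `smallnessG_count124_iff` (owner ruling R30 (iii): the sharp
smallness reads `G < (θ′ − L⁻¹)(1 − ρ₀)∕(6L)⁴`; the (1.24)-count costs `L⁴` against the ε₁-smallness of (2.41); symbolic in print).
UNITS (owner ruling R30 (i); `c` is exponent-critical).  `InsScaleBoundLevel W κ c ω` measures the displacement in the step model's
HISTORY-MARGIN units `rHist k`; the pair `((6L)⁴, L⁻¹)` of §6 holds for ANY `rHist`, `F.wt` satisfying the displayed WEIGHT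
DICTIONARY `weightOf P κ₁ d0 O1 Kp k (out i) ≤ rHist (k+1)·F.wt i` — print's (1.29) weight per unit of E₀ of the output index is at
most ONE level-format unit of the entry per margin.  For the Hist of record with the (1.36) level format and the margin
`B13HistDatum.histMargin λ μ k = λ − μ` (the (1.36)-budget slack, record §25∕§27) the dictionary is the displayed inequality
`weightOf ≤ (λ − μ)·(level format)`, relating `Kp` (print's 8B₀C₁e^{16κ₁}α₂⁻¹(α₁∕α₃)⁵-type constant) to the slack — a HYPOTHESIS
(`hwt`), not discharged.
STATUS (census, Edison rule).  A junction: discharges NO estimate of [II]; it makes W3 of row NE5, for insertions that READ an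
NE9 channel, THE SAME displayed binder as NE9's S5 (one analytic input serves both rows; `PieceBound` stays DISPLAYED in both
rows — W3 is discharged INTO NE9's displayed binder, not from print) and makes `c`, `ω` of W3 EXPLICIT for the piece form.
The reading `ReadsChannel` is MODEL LEVEL — an MI-R-class identification (owner R8), not an estimate; no claim that Bałaban's
(1.33) is read this way by a constructed step model (0/12 leaves on Bałaban's concrete objects, unchanged).  Headline wording
(owner R30 (ii)): «NE5 leaf L09 (W3) READ FROM row NE9's S5 ∕ `PieceBound` for channel-reading insertions», never «W3 proved».
NE5 NOT PROVED; NE9 NOT PROVED; spine 0/9; rung (B)+1 finite T⁴; NOT infinite volume ∕ mass gap ∕ Clay.  Axioms ⊆ {propext,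
Classical.choice, Quot.sound}.
-/

noncomputable section

open scoped BigOperators
open Finset MeasureTheory

namespace Summit.QuantumFields.BalabanUV.T4Continuum.InsertionChannelReading

open Literature.MathematicalPhysics.QuantumFieldTheory.Balaban1983to89
open Literature.MathematicalPhysics.QuantumFieldTheory.Balaban1983to89.T4OutputRate (Carriers)
open Literature.MathematicalPhysics.QuantumFieldTheory.Balaban1983to89.T4InputCauchyRateData (StepModel)
open Literature.MathematicalPhysics.QuantumFieldTheory.Balaban1983to89.T4HistoryLipschitzRecursion
  (ChannelAdditive ChannelLocal ChannelSizeAtStepNN truncScale)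
open Summit.QuantumFields.BalabanUV.T4Continuum.B13HistDatum (HistFrame Entry Hist)
open Summit.QuantumFields.BalabanUV.T4Continuum.NE9EvaluationChannel (evalChannel EvalAdm channelAdditive_eval channelLocal_eval
  channelSizeAtStepNN_of_kernelMass)
open Summit.QuantumFields.BalabanUV.T4Continuum.NE9Lemma1Counting (PieceData pieceChannel SrcScale PieceBound LevelCounts weightOf
  tauOf ellPrinted channelAdditive_piece channelLocal_piece channelSizeAtStepNN_piece_printed)

variable {C : Carriers} {Bg ι : Type}

/-! ## §1 Background-constant families, the homogeneity shape, and the read-out dictionary of the Hist of record -/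

section ConstFam

/-- [folklore] THE BACKGROUND-CONSTANT FAMILY of a table of values: `constFam t U X = t X` for every background `U` (the P1
model's reading of the earlier terms as VALUES at the run's background — `B13HistInsertion` MODELLING NOTE, owner R8). -/
def constFam (t : C.Dom → ℝ) : Bg → C.Dom → ℝ := fun _ X => t X

/-- [folklore] `constFam` evaluates to the table. -/ @[simp] theorem constFam_apply (t : C.Dom → ℝ) (U : Bg) (X : C.Dom) : constFam (Bg := Bg) t U X = t X := rfl

/-- [folklore] `constFam` is additive. -/ theorem constFam_sub (t t' : C.Dom → ℝ) : constFam (Bg := Bg) (t - t') = constFam t - constFam t' := rfl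
/-- [folklore] `constFam` is homogeneous. -/ theorem constFam_smul (a : ℝ) (t : C.Dom → ℝ) : constFam (Bg := Bg) (a • t) = a • constFam t := rfl
/-- [folklore] `constFam` sends the zero table to the zero family. -/
@[simp] theorem constFam_zero : constFam (Bg := Bg) (0 : C.Dom → ℝ) = 0 := rfl

/-- [folklore] Tables that agree on the scales `≤ k` have the same step-`k` truncated constant families. -/
theorem truncScale_constFam_eq {k : ℕ} {t t' : C.Dom → ℝ} (h : ∀ Y, C.scale Y ≤ k → t Y = t' Y) :
    truncScale k (constFam (Bg := Bg) t) = truncScale k (constFam t') := by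
  funext U X
  simp only [truncScale, constFam_apply]
  by_cases hX : C.scale X ≤ k
  · rw [if_pos hX, if_pos hX, h X hX]
  · rw [if_neg hX, if_neg hX]

/-- [folklore] HYPOTHESIS SHAPE `ChannelHomog Adm T` (printed STRUCTURE, displayed): the channel is ℝ-HOMOGENEOUS in the old
terms on the admissible class — with `ChannelAdditive` this is the linearity of (1.33) p. 9 in each earlier term (every
localization operation (1.10)∕(1.22)–(1.24) p. 6–7 is linear).  `T4HistoryLipschitzRecursion` displays additivity only, and
`NE9Lemma1Counting` types the pieces of (1.23) as additive maps `(Bg → ℝ) →+ ℝ`; homogeneity is therefore a separate binder —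
PROVED for the evaluation channels of `NE9EvaluationChannel` (`channelHomog_eval`, §5). -/
def ChannelHomog (Adm : Set (Bg → C.Dom → ℝ)) (T : ℕ → (ℕ → ℝ) → (Bg → C.Dom → ℝ) → ι → ℝ) : Prop :=
  ∀ (k : ℕ) (s : ℕ → ℝ), ∀ H ∈ Adm, ∀ (a : ℝ) (y : ι), T k s (a • H) y = a * T k s H y

end ConstFam

section ReadOut

variable {F : HistFrame C}

/-- [folklore] The physical read-out is additive (it is the bounded linear functional `F.readCLM i`). -/
theorem read_sub (h h' : Hist F) (i : F.Idx) : F.read (h - h') i = F.read h i - F.read h' i := by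
  rw [← F.readCLM_apply, ← F.readCLM_apply, ← F.readCLM_apply, map_sub]

/-- [folklore] The physical read-out is ℂ-homogeneous. -/
theorem read_smul (c : ℂ) (h : Hist F) (i : F.Idx) : F.read (c • h) i = c * F.read h i := by
  rw [← F.readCLM_apply, ← F.readCLM_apply, map_smul, smul_eq_mul]

/-- [folklore] READ-INJECTIVITY of the Hist of record: two tables with the same physical read-outs are equal (the weights are
positive). -/
theorem eq_of_read_eq {h h' : Hist F} (hr : ∀ i, F.read h i = F.read h' i) : h = h' := by
  refine BoundedContinuousFunction.ext fun e => ?_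
  obtain ⟨i⟩ := e
  have hw : (F.wt i : ℂ) ≠ 0 := Complex.ofReal_ne_zero.2 (F.wt_pos i).ne'
  have := hr i
  simp only [HistFrame.read] at this
  exact mul_left_cancel₀ hw this

end ReadOut

/-! ## §2 The reading: a step model whose insertion reads a channel on background-constant families -/

section Reads

variable {Op : Type*} [NormedAddCommGroup Op] [NormedSpace ℂ Op] {F : HistFrame C}

/-- [folklore] HYPOTHESIS SHAPE (reading, MODEL LEVEL) `ReadsChannel M T out W`: on the window `W`, run A's history insertion of
the step model `M` (valued in the Hist of record `Hist F`) READS the localization channel `T` — step `0` inserts nothing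
table-driven (`zero`), and at step `k + 1` the table-driven part of the inserted history, READ AT THE ENTRY `i`, is the channel
output at index `out i` of the step-`k` channel on the background-constant family of the table, with the run's couplings as the
comparison history (`succ`).  (The shift `k + 1 ↔ k`: NE5's step-`k` insertion reads the scales `< k`, NE9's `T k` reads the
creation steps `≤ k`.)  Nothing of [II] is asserted: whether Bałaban's (1.33) is read this way by a constructed step model is an
instantiation (0/12), not this shape. -/
structure ReadsChannel (M : StepModel C Op (Hist F)) (T : ℕ → (ℕ → ℝ) → (Bg → C.Dom → ℝ) → ι → ℝ) (out : F.Idx → ι)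
    (W : Set (ℕ → ℝ)) : Prop where
  /-- step `0` inserts nothing table-driven -/
  zero : ∀ g ∈ W, ∀ (U : C.BgB) (t : C.Dom → ℝ), M.insA g U 0 t = M.insA g U 0 0
  /-- at step `k + 1` the table-driven part, read at an entry, is the step-`k` channel output on the constant family -/
  succ : ∀ k, ∀ g ∈ W, ∀ (U : C.BgB) (t : C.Dom → ℝ) (i : F.Idx),
    F.read (M.insA g U (k + 1) t) i - F.read (M.insA g U (k + 1) 0) i = ((T k g (constFam t) (out i) : ℝ) : ℂ)

variable {M : StepModel C Op (Hist F)} {T : ℕ → (ℕ → ℝ) → (Bg → C.Dom → ℝ) → ι → ℝ} {out : F.Idx → ι}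
  {W : Set (ℕ → ℝ)} {Adm : Set (Bg → C.Dom → ℝ)}

/-- [folklore] Under the reading, the read-out of a DIFFERENCE of two inserted histories at step `k + 1` is the difference of
the channel outputs on the two constant families. -/
theorem read_insA_sub_insA (hR : ReadsChannel M T out W) (k : ℕ) {g : ℕ → ℝ} (hg : g ∈ W) (U : C.BgB)
    (t t' : C.Dom → ℝ) (i : F.Idx) :
    F.read (M.insA g U (k + 1) t - M.insA g U (k + 1) t') i =
      ((T k g (constFam t) (out i) - T k g (constFam t') (out i) : ℝ) : ℂ) := by
  rw [read_sub, Complex.ofReal_sub, ← hR.succ k g hg U t i, ← hR.succ k g hg U t' i]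
  ring

/-! ## §3 The structure binders of the END faces from the channel's structure binders -/

/-- [folklore] **`InsBlind` FROM `ChannelLocal`**: if the step-`k` channel reads only the creation steps `≤ k`
(`ChannelLocal`, printed structure) and the constant families are admissible, the step model's insertion is blind above its
scale — tables agreeing on the scales `< k` insert the same history. -/
theorem insBlind_of_readsChannel (hR : ReadsChannel M T out W) (hloc : ChannelLocal Adm T)
    (hadm : ∀ t : C.Dom → ℝ, constFam (Bg := Bg) t ∈ Adm) : M.InsBlind W := by
  intro k g hg U t t' htt'
  cases k with
  | zero => rw [hR.zero g hg U t, hR.zero g hg U t']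
  | succ k =>
    refine eq_of_read_eq fun i => ?_
    have hT : T k g (constFam t) (out i) = T k g (constFam t') (out i) := by
      rw [hloc k g _ (hadm t) (out i), hloc k g _ (hadm t') (out i),
        truncScale_constFam_eq fun Y hY => htt' Y (Nat.lt_succ_of_le hY)]
    have h := read_insA_sub_insA hR k hg U t t' i
    rw [hT, sub_self, Complex.ofReal_zero, read_sub, sub_eq_zero] at h
    exact h

/-- [folklore] **`InsAffine` FROM `ChannelAdditive`**: differences of inserted histories are the insertion of the difference
table off the base part — read-out by read-out this is the additivity of the channel on the constant families. -/
theorem insAffine_of_readsChannel (hR : ReadsChannel M T out W) (hadd : ChannelAdditive Adm T)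
    (hadm : ∀ t : C.Dom → ℝ, constFam (Bg := Bg) t ∈ Adm) : M.InsAffine W := by
  intro k g hg U t t'
  cases k with
  | zero => rw [hR.zero g hg U t, hR.zero g hg U t', hR.zero g hg U (t - t'), sub_self]
  | succ k =>
    refine eq_of_read_eq fun i => ?_
    rw [read_insA_sub_insA hR k hg U t t' i, read_insA_sub_insA hR k hg U (t - t') 0 i, constFam_sub,
      hadd k g _ (hadm t) _ (hadm t') (out i), constFam_zero]
    have h0 : T k g (0 : Bg → C.Dom → ℝ) (out i) = 0 := by
      have h := hadd k g _ (hadm 0) _ (hadm 0) (out i)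
      rw [constFam_zero, sub_self] at h
      linarith
    rw [h0, sub_zero]

/-- [folklore] **`InsHomog` FROM `ChannelHomog`**: the table-driven part of the insertion is ℝ-homogeneous — read-out by read-out
the homogeneity of the channel on the constant families. -/
theorem insHomog_of_readsChannel (hR : ReadsChannel M T out W) (hhom : ChannelHomog Adm T)
    (hadm : ∀ t : C.Dom → ℝ, constFam (Bg := Bg) t ∈ Adm) : M.InsHomog W := by
  intro k g hg U a t
  cases k with
  | zero => rw [hR.zero g hg U (a • t), hR.zero g hg U t, sub_self, smul_zero]
  | succ k =>
    refine eq_of_read_eq fun i => ?_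
    rw [read_sub, hR.succ k g hg U (a • t) i, read_smul, read_sub, hR.succ k g hg U t i, constFam_smul,
      hhom k g _ (hadm t) a (out i), Complex.ofReal_mul]

/-! ## §4 W3 from the channel's size binder and the weight dictionary -/

/-- [folklore] **W3 FROM NE9's SIZE BINDER S5** — `M.InsScaleBoundLevel W κ c ω` from: the reading, admissible constant families,
`ChannelSizeAtStepNN Adm T κ wt τ` (row NE9's displayed per-creation-step size binder, BY NAME), the profile `τ k j ≤ c·ω^{k−j}`
(`0 ≤ c`, `0 ≤ ω`), and the WEIGHT DICTIONARY `0 ≤ wt k (out i) ≤ rHist (k+1)·F.wt i` (the channel's weight of an output index is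
at most the entry's level format in units of the history margin).  Read-out by read-out: a scale-`j` table of level `T·e^{−κd}`
gives `|T k g (constFam t) (out i)| ≤ wt·τ k j·T ≤ rHist·F.wt i·c·ω^{k−j}·T`, and `HistFrame.norm_le_iff_read` assembles the
Hist norm. -/
theorem insScaleBoundLevel_of_readsChannel {κ c ω : ℝ} {wt : ℕ → ι → ℝ} {τ : ℕ → ℕ → ℝ} (hR : ReadsChannel M T out W)
    (hadm : ∀ t : C.Dom → ℝ, constFam (Bg := Bg) t ∈ Adm) (hsize : ChannelSizeAtStepNN Adm T κ wt τ)
    (hwt0 : ∀ k i, 0 ≤ wt k (out i)) (hwt : ∀ k i, wt k (out i) ≤ M.rHist (k + 1) * F.wt i)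
    (hτ : ∀ k j, j ≤ k → τ k j ≤ c * ω ^ (k - j)) (hc : 0 ≤ c) (hω : 0 ≤ ω) : M.InsScaleBoundLevel W κ c ω := by
  intro k g hg U t j N hj hN hsupp hbd
  cases k with
  | zero => exact absurd hj (Nat.not_lt_zero j)
  | succ k =>
    have hjk : j ≤ k := Nat.lt_succ_iff.1 hj
    have hkj : k + 1 - 1 - j = k - j := by omega
    rw [hkj]
    have hμ : 0 ≤ M.rHist (k + 1) * (c * (ω ^ (k - j) * N)) :=
      mul_nonneg (M.rHist_pos _).le (mul_nonneg hc (mul_nonneg (pow_nonneg hω _) hN))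
    refine (F.norm_le_iff_read _ hμ).2 fun i => ?_
    rw [read_sub, hR.succ k g hg U t i, Complex.norm_real, Real.norm_eq_abs]
    have hHsupp : ∀ (U' : Bg) (X : C.Dom), C.scale X ≠ j → constFam (Bg := Bg) t U' X = 0 := fun U' X hX => hsupp X hX
    have hHbd : ∀ (U' : Bg) (X : C.Dom), C.scale X = j → |constFam (Bg := Bg) t U' X| ≤ Real.exp (-(κ * C.d X)) * N :=
      fun U' X hX => by rw [constFam_apply, mul_comm]; exact hbd X hX
    calc |T k g (constFam t) (out i)| ≤ wt k (out i) * (τ k j * N) :=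
          hsize k j hjk g _ (hadm t) hHsupp N hN hHbd (out i)
      _ ≤ wt k (out i) * (c * ω ^ (k - j) * N) :=
          mul_le_mul_of_nonneg_left (mul_le_mul_of_nonneg_right (hτ k j hjk) hN) (hwt0 k i)
      _ ≤ M.rHist (k + 1) * F.wt i * (c * ω ^ (k - j) * N) :=
          mul_le_mul_of_nonneg_right (hwt k i) (mul_nonneg (mul_nonneg hc (pow_nonneg hω _)) hN)
      _ = M.rHist (k + 1) * (c * (ω ^ (k - j) * N)) * F.wt i := by ring

/-- [folklore] **W3 AT THE REFERENCE LEVEL `E₁ ≥ 0`** (`StepModel.InsScaleBound`, = cell gap G-ne5p1-3a″, BY NAME) from the same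
inputs. -/
theorem insScaleBound_of_readsChannel {κ E₁ c ω : ℝ} {wt : ℕ → ι → ℝ} {τ : ℕ → ℕ → ℝ} (hR : ReadsChannel M T out W)
    (hadm : ∀ t : C.Dom → ℝ, constFam (Bg := Bg) t ∈ Adm) (hsize : ChannelSizeAtStepNN Adm T κ wt τ)
    (hwt0 : ∀ k i, 0 ≤ wt k (out i)) (hwt : ∀ k i, wt k (out i) ≤ M.rHist (k + 1) * F.wt i)
    (hτ : ∀ k j, j ≤ k → τ k j ≤ c * ω ^ (k - j)) (hc : 0 ≤ c) (hω : 0 ≤ ω) (hE₁ : 0 ≤ E₁) :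
    M.InsScaleBound W κ E₁ c ω := fun k g hg U t j hj hsupp hbd =>
  insScaleBoundLevel_of_readsChannel hR hadm hsize hwt0 hwt hτ hc hω k g hg U t j E₁ hj hE₁ hsupp hbd

/-- [folklore] **THE FOUR INSERTION BINDERS OF THE NE5 END FACES FROM THE NE9 CHANNEL BINDERS** under the reading:
`InsAffine ∧ InsBlind ∧ InsHomog ∧ InsScaleBound W κ E₁ c ω` ⟸ `ChannelAdditive`, `ChannelLocal`, `ChannelHomog`,
`ChannelSizeAtStepNN` + profile + weight dictionary. -/
theorem insertion_binders_of_readsChannel {κ E₁ c ω : ℝ} {wt : ℕ → ι → ℝ} {τ : ℕ → ℕ → ℝ} (hR : ReadsChannel M T out W)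
    (hadm : ∀ t : C.Dom → ℝ, constFam (Bg := Bg) t ∈ Adm) (hadd : ChannelAdditive Adm T) (hloc : ChannelLocal Adm T)
    (hhom : ChannelHomog Adm T) (hsize : ChannelSizeAtStepNN Adm T κ wt τ) (hwt0 : ∀ k i, 0 ≤ wt k (out i))
    (hwt : ∀ k i, wt k (out i) ≤ M.rHist (k + 1) * F.wt i) (hτ : ∀ k j, j ≤ k → τ k j ≤ c * ω ^ (k - j)) (hc : 0 ≤ c)
    (hω : 0 ≤ ω) (hE₁ : 0 ≤ E₁) : M.InsAffine W ∧ M.InsBlind W ∧ M.InsHomog W ∧ M.InsScaleBound W κ E₁ c ω :=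
  ⟨insAffine_of_readsChannel hR hadd hadm, insBlind_of_readsChannel hR hloc hadm, insHomog_of_readsChannel hR hhom hadm,
    insScaleBound_of_readsChannel hR hadm hsize hwt0 hwt hτ hc hω hE₁⟩

end Reads

/-! ## §5 NE9-P2's evaluation channels: homogeneity, admissible constants, and W3 from the kernel-mass inequality -/

section Eval

variable {Ω : Type*} [MeasurableSpace Ω] {F₀ : ℕ → (ℕ → ℝ) → ι → Finset C.Dom} {ν : ℕ → (ℕ → ℝ) → ι → C.Dom → Measure Ω}
  {w : ℕ → (ℕ → ℝ) → ι → C.Dom → Ω → ℝ} {bg : ℕ → (ℕ → ℝ) → ι → C.Dom → Ω → Bg}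

/-- [folklore] **`ChannelHomog` FOR EVERY EVALUATION CHANNEL** (integrals are linear: `integral_const_mul`; no integrability
hypothesis). -/
theorem channelHomog_eval (Adm : Set (Bg → C.Dom → ℝ)) : ChannelHomog Adm (evalChannel F₀ ν w bg) := by
  intro k s H _ a y
  simp only [evalChannel, Finset.mul_sum, ← integral_const_mul]
  refine Finset.sum_congr rfl fun X _ => integral_congr_ae (Filter.Eventually.of_forall fun ω => ?_)
  simp only [Pi.smul_apply, smul_eq_mul]
  ring

/-- [folklore] Constant families are admissible for an evaluation channel with integrable weights. -/
theorem constFam_mem_evalAdm (hw : ∀ k s y, ∀ X ∈ F₀ k s y, Integrable (w k s y X) (ν k s y X)) (t : C.Dom → ℝ) :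
    constFam (Bg := Bg) t ∈ EvalAdm F₀ ν w bg := fun k s y X hX => by
  simpa only [constFam_apply] using (hw k s y X hX).mul_const (t X)

variable {Op : Type*} [NormedAddCommGroup Op] [NormedSpace ℂ Op] {F : HistFrame C} {M : StepModel C Op (Hist F)}
  {out : F.Idx → ι} {W : Set (ℕ → ℝ)}

/-- [folklore] **THE FOUR NE5 INSERTION BINDERS FOR A STEP MODEL READING AN EVALUATION CHANNEL** (NE9-P2's FORM of (1.23)∕(1.33):
`T k s H y = Σ_{X ∈ F₀ k s y} ∫ w·H(bg ·) X ∂ν`): from the reading, integrable weights, source locality (`scale X ≤ k` on `F₀ k s y`),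
THE KERNEL-MASS INEQUALITY `Σ_{X ∈ F₀ k s y, scale X = j} e^{−κd(X)}·∫|w k s y X| ∂ν ≤ wt k y·τ k j` (NE9-P2's displayed analytic binder —
`channelSizeAtStepNN_of_kernelMass` BY NAME), the profile and the weight dictionary:
`InsAffine ∧ InsBlind ∧ InsHomog ∧ InsScaleBound W κ E₁ c ω`.  ONE displayed inequality serves rows NE5 (W3) and NE9 (S5). -/
theorem insertion_binders_of_readsEvalChannel {κ E₁ c ω : ℝ} {wt : ℕ → ι → ℝ} {τ : ℕ → ℕ → ℝ}
    (hR : ReadsChannel M (evalChannel F₀ ν w bg) out W)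
    (hw : ∀ k s y, ∀ X ∈ F₀ k s y, Integrable (w k s y X) (ν k s y X)) (hF : ∀ k s y, ∀ X ∈ F₀ k s y, C.scale X ≤ k)
    (hmass : ∀ (k j : ℕ) (s : ℕ → ℝ) (y : ι),
      ∑ X ∈ (F₀ k s y).filter (fun X => C.scale X = j), Real.exp (-(κ * C.d X)) * ∫ ω', |w k s y X ω'| ∂(ν k s y X) ≤
        wt k y * τ k j)
    (hwt0 : ∀ k i, 0 ≤ wt k (out i)) (hwt : ∀ k i, wt k (out i) ≤ M.rHist (k + 1) * F.wt i)
    (hτ : ∀ k j, j ≤ k → τ k j ≤ c * ω ^ (k - j)) (hc : 0 ≤ c) (hω : 0 ≤ ω) (hE₁ : 0 ≤ E₁) :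
    M.InsAffine W ∧ M.InsBlind W ∧ M.InsHomog W ∧ M.InsScaleBound W κ E₁ c ω :=
  insertion_binders_of_readsChannel hR (constFam_mem_evalAdm hw) channelAdditive_eval (channelLocal_eval hF)
    (channelHomog_eval _) (channelSizeAtStepNN_of_kernelMass hw hmass) hwt0 hwt hτ hc hω hE₁

end Eval

/-! ## §6 NE9-P1's PIECE FORM of (1.23)∕(1.33): W3 with `c = (6L)⁴`, `ω = L⁻¹` from `PieceBound` + `LevelCounts` -/

section Piece

variable {α β γ : Type} {Op : Type*} [NormedAddCommGroup Op] [NormedSpace ℂ Op] {F : HistFrame C}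
  {M : StepModel C Op (Hist F)} {out : F.Idx → ι} {W : Set (ℕ → ℝ)} {P : PieceData C Bg ι α β γ}

/-- [folklore] The counting weight `weightOf P κ₁ d0 O1 Kp k y = Kp·O1·e·exp(⅛κ₁d₀)·exp(−(1/16)κ₁d_k(Y))` is nonnegative for
`Kp, O1 ≥ 0`. -/
theorem weightOf_nonneg {κ₁ d0 O1 : ℝ} {Kp : ℕ → ι → ℝ} (hKp : ∀ k y, 0 ≤ Kp k y) (hO1 : 0 ≤ O1) (k : ℕ) (y : ι) :
    0 ≤ weightOf P κ₁ d0 O1 Kp k y :=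
  mul_nonneg (mul_nonneg (mul_nonneg (mul_nonneg (hKp k y) hO1) (Real.exp_pos _).le) (Real.exp_pos _).le)
    (Real.exp_pos _).le

/-- [folklore] **`InsBlind ∧ InsAffine` FOR A STEP MODEL READING A PIECE CHANNEL** (`channelLocal_piece` ∕ `channelAdditive_piece`
hold on ANY class — take `Adm := univ`; `SrcScale`: the sources of the step-`j` block have creation step `j`).  `InsHomog` is NOT
derived: NE9 types the pieces as additive maps only; it stays the displayed `ChannelHomog univ (pieceChannel P)`
(`insHomog_of_readsChannel`). -/
theorem insBlind_insAffine_of_readsPieceChannel (hR : ReadsChannel M (pieceChannel P) out W) (hsrc : SrcScale P) :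
    M.InsBlind W ∧ M.InsAffine W :=
  ⟨insBlind_of_readsChannel (Adm := Set.univ) hR (channelLocal_piece hsrc _) fun _ => Set.mem_univ _,
    insAffine_of_readsChannel (Adm := Set.univ) hR (channelAdditive_piece P _) fun _ => Set.mem_univ _⟩

/-- [folklore] **W3 WITH PRINT's AGE DAMPING FOR A STEP MODEL READING THE PIECE FORM**: `M.InsScaleBoundLevel W κ ((6L)⁴) L⁻¹` —
`c = (6L)⁴`, `ω = L⁻¹` EXPLICIT (p. 8 l. 9–10 *"This yields (6L)⁴Lʲη"*, `Lʲη = (L⁻¹)^{k−j}`) — from the reading, `SrcScale`, the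
(1.24)×(1.25)-SHAPE per-piece bound `PieceBound P κ κ₁ d0 Kp (ellPrinted L)` (row NE9's displayed analytic binder; proof-interior
of [I] §§3–5, NOT a printed statement, NOT proved here), the level counts `LevelCounts P κ κ₁ O1 L (ellPrinted L)` ((1.26)–(1.28)
p. 8; a hypothesis — the GAIN variant `LevelCountsG … (agePow ω)` is row NE9's theorem on the carriers of record modulo identification
binders, `levelCountsG_of_record₅_agePow` [DOCFIX v1.0.1]), `0 ≤ Kp`, `0 ≤ O1`, `1 < L`, and the weight dictionary for the
counting weight `weightOf P κ₁ d0 O1 Kp` ((1.29)'s per-index weight ≤ the entry's level format in history-margin units) —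
`channelSizeAtStepNN_piece_printed` BY NAME.  UNITS (owner R30 (i)): the pair `((6L)⁴, L⁻¹)` refers to the margin sequence
`M.rHist` of the weight dictionary `hwt` — any `rHist`, `F.wt` with `weightOf … k (out i) ≤ rHist (k+1)·F.wt i`; see the module
header for the Hist of record with the (1.36)-budget slack as margin. -/
theorem insScaleBoundLevel_of_readsPieceChannel {κ κ₁ d0 O1 L : ℝ} {Kp : ℕ → ι → ℝ}
    (hR : ReadsChannel M (pieceChannel P) out W) (hsrc : SrcScale P) (hL1 : 1 < L)
    (hPiece : PieceBound P κ κ₁ d0 Kp (ellPrinted L)) (hLev : LevelCounts P κ κ₁ O1 L (ellPrinted L))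
    (hKp : ∀ k y, 0 ≤ Kp k y) (hO1 : 0 ≤ O1)
    (hwt : ∀ k i, weightOf P κ₁ d0 O1 Kp k (out i) ≤ M.rHist (k + 1) * F.wt i) :
    M.InsScaleBoundLevel W κ ((6 * L) ^ 4) L⁻¹ := by
  obtain ⟨hsize, hprof, hω, _⟩ := channelSizeAtStepNN_piece_printed hL1 hsrc hPiece hLev hKp hO1 (Set.univ : Set (Bg → C.Dom → ℝ))
  exact insScaleBoundLevel_of_readsChannel hR (fun _ => Set.mem_univ _) hsize
    (fun k i => weightOf_nonneg hKp hO1 k (out i)) hwt hprof (by positivity) hω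

/-- [folklore] **W3 AT THE REFERENCE LEVEL for the piece form**: `M.InsScaleBound W κ E₁ ((6L)⁴) L⁻¹` (G-ne5p1-3a″'s shape BY NAME,
`c`, `ω` explicit — the `hunit` binder of `OutputRateCount124.ne5_at_of_stepModel_fibre_count124_nat`) from the same inputs and
`0 ≤ E₁`. -/
theorem insScaleBound_of_readsPieceChannel {κ κ₁ d0 O1 L E₁ : ℝ} {Kp : ℕ → ι → ℝ}
    (hR : ReadsChannel M (pieceChannel P) out W) (hsrc : SrcScale P) (hL1 : 1 < L)
    (hPiece : PieceBound P κ κ₁ d0 Kp (ellPrinted L)) (hLev : LevelCounts P κ κ₁ O1 L (ellPrinted L))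
    (hKp : ∀ k y, 0 ≤ Kp k y) (hO1 : 0 ≤ O1)
    (hwt : ∀ k i, weightOf P κ₁ d0 O1 Kp k (out i) ≤ M.rHist (k + 1) * F.wt i) (hE₁ : 0 ≤ E₁) :
    M.InsScaleBound W κ E₁ ((6 * L) ^ 4) L⁻¹ := fun k g hg U t j hj hsupp hbd =>
  insScaleBoundLevel_of_readsPieceChannel hR hsrc hL1 hPiece hLev hKp hO1 hwt k g hg U t j E₁ hj hE₁ hsupp hbd

end Piece

end Summit.QuantumFields.BalabanUV.T4Continuum.InsertionChannelReading

end
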